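import Summits.Ventures.DiscreteObjects.Hadamard.FixedRowsOrbitTools

/-!
# Hadamard matrices of order 3p + 3 (p ≥ 5 prime) have no automorphism of order p (kernel)

Framing: lottery ticket; floor = certified bounds/negative ranges.

Cell pub-namedobj (venture DiscreteObjects), target (H), hadamard gen 9.  A general NONEXISTENCE statement obtained with the
fixed-row tools of `FixedRowsOrbitTools`: **`no_hadamard_signedAut_order3p3` — a Hadamard matrix of order `3p + 3`, `p ≥ 5`
prime, has no signed-permutation automorphism `(π, κ, d, e)` with `π^p = κ^p = 1` other than `(1, 1)`.**  Orders covered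
(`3p + 3 ≡ 0 (mod 4)`, i.e. `p ≡ 3 (mod 4)`): `24 (p = 7)`, `36 (11)`, `60 (19)`, `72 (23)`, `96 (31)`, `132 (43)`, `144 (47)`, …;
the case `24 / 7` is what kills the order-7 symmetry ansatz for the 24-fixed type of the Z₂₃ orbit matrix of H(668)
(FAMILY-F12-G9 §6).  Proof.  Let `f` and `w` be the numbers of `κ`-fixed columns and `κ`-classes, `f + p w = 3p + 3`, so
`(w, f) ∈ {(0, 3p+3), (1, 2p+3), (2, p+3), (3, 3)}`, and likewise `f_r ≡ 3 (mod p)` for the `π`-fixed rows, hence `f_r ≥ 3`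
unless … (it is always `≥ 3`).  `w = 3`: `f = 3 < p`, two fixed rows are orthogonal on the three fixed columns
(`hadamard_fixedRows_orth_of_card_lt`) — a vanishing sum of three `±1`'s, absurd.  `w = 2`: `f = p + 3 < 2p` is even, so the
fixed part `S` of the product of two fixed rows is even, divisible by `p` and `|S| < 2p`, hence `0`; then the class part
vanishes too and the vectors `(H u (rep C))_C ∈ {±1}²` of three fixed rows are pairwise orthogonal — absurd
(`card_le_of_pairwise_orthogonal`).  `w = 1`: `f = 2p + 3`, `S = −p ψ_u ψ_u'`, and for four fixed rows
`0 ≤ Σ_j (Σ_i ψ_i H u_i j)² = 4(2p+3) − 12p < 0`; so `f_r ≤ 3`, i.e. `f_r = 3`, and the transposed matrix is in case `w = 3` —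
absurd.  `w = 0`: `κ = 1`, hence `π = 1` (`signedAut_snd_eq_one`).  Print status: consistent with the known automorphism groups
of the classified orders (e.g. no H(24) has `7 ∣ |Aut|`); the uniform statement is recorded as ours/folklore.  No `sorry`.
-/

open Finset BigOperators Matrix

namespace Summit.Ventures.DiscreteObjects.Hadamard

open Literature.Combinatorics.Designs.GoethalsSeidel (IsHadamardMatrix)

variable {ι : Type*} [Fintype ι] [DecidableEq ι]

section order3p3

variable {H : Matrix ι ι ℤ} {π κ : Equiv.Perm ι} {d e : ι → ℤ} {p : ℕ}

/-- the product of two entries is `±1` -/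
private lemma entryProd_pm3 (hH : IsHadamardMatrix H) (i i' j j' : ι) :
    H i j * H i' j' = 1 ∨ H i j * H i' j' = -1 := by
  rcases hH.1 i j with h | h <;> rcases hH.1 i' j' with h' | h' <;> simp [h, h']

/-- `w = 3`, `f = 3`: two fixed rows are impossible -/
private lemma case_w3 (hH : IsHadamardMatrix H) (haut : IsSignedAut H π κ d e) (hp : p.Prime) (hp5 : 5 ≤ p)
    (hκ : κ ^ p = 1) {u u' : ι} (hu : π u = u) (hu' : π u' = u') (huu' : u ≠ u')
    (hf : (univ.filter fun j => κ j = j).card = 3) : False := by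
  have hodd : Odd p := hp.odd_of_ne_two (by omega)
  have hlt : (univ.filter fun j => κ j = j).card < p := by rw [hf]; omega
  have h0 := (hadamard_fixedRows_orth_of_card_lt hH π κ d e haut hp hodd hκ hlt hu hu' huu').1
  have hpar := two_dvd_sum_pm_sub_card (univ.filter fun j => κ j = j) (fun j => H u j * H u' j)
    (fun j _ => entryProd_pm3 hH _ _ _ _)
  rw [h0, hf] at hpar
  omega

/-- `w = 2`, `f = p + 3`: three fixed rows are impossible -/
private lemma case_w2 (hH : IsHadamardMatrix H) (haut : IsSignedAut H π κ d e) (hp : p.Prime) (hp5 : 5 ≤ p)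
    (hκ : κ ^ p = 1) (uu : Fin 3 → ι) (huu : Function.Injective uu) (hfix : ∀ i, π (uu i) = uu i)
    (rep : Finset ι → ι) (hrep : ∀ C ∈ blockClasses κ p, rep C ∈ C)
    (hk : (blockClasses κ p).card = 2) (hf : (univ.filter fun j => κ j = j).card = p + 3) : False := by
  have hodd : Odd p := hp.odd_of_ne_two (by omega)
  set Fc := (univ.filter fun j => κ j = j) with hFc
  have hT : ∀ i i', i ≠ i' → ∑ C ∈ blockClasses κ p, H (uu i) (rep C) * H (uu i') (rep C) = 0 := by
    intro i i' hii'
    have hs := fixedRows_split hH haut hp hodd hκ (hfix i) (hfix i') (huu.ne hii') rep hrep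
    have hpm : ∀ j ∈ Fc, H (uu i) j * H (uu i') j = 1 ∨ H (uu i) j * H (uu i') j = -1 :=
      fun j _ => entryProd_pm3 hH _ _ _ _
    have habs := abs_sum_pm_le_card Fc (fun j => H (uu i) j * H (uu i') j) hpm
    have hpar := two_dvd_sum_pm_sub_card Fc (fun j => H (uu i) j * H (uu i') j) hpm
    rw [hf] at habs hpar
    obtain ⟨c, hc⟩ := hpar
    obtain ⟨m, hm⟩ := hodd
    have hb := abs_le.mp habs
    set S := ∑ j ∈ Fc, H (uu i) j * H (uu i') j with hS
    set T := ∑ C ∈ blockClasses κ p, H (uu i) (rep C) * H (uu i') (rep C) with hTdef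
    push_cast at hb hc hs
    -- S = -p T, S even, |S| ≤ p + 3 < 2p ⇒ T = 0
    have hpos : (0 : ℤ) < p := by exact_mod_cast hp.pos
    by_contra hT0
    rcases lt_or_gt_of_ne hT0 with hlt | hgt
    · -- T ≤ -1
      rcases Int.le_iff_eq_or_lt.mp (show T ≤ -1 by omega) with hT1 | hT2
      · -- T = -1: S = p, odd vs even
        rw [hT1] at hs
        omega
      · have : (p : ℤ) * T ≤ (p : ℤ) * (-2) := mul_le_mul_of_nonneg_left (by omega) hpos.le
        nlinarith
    · rcases Int.le_iff_eq_or_lt.mp (show 1 ≤ T by omega) with hT1 | hT2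
      · rw [← hT1] at hs
        omega
      · have : (p : ℤ) * 2 ≤ (p : ℤ) * T := mul_le_mul_of_nonneg_left (by omega) hpos.le
        nlinarith
  let v : Fin 3 → {C // C ∈ blockClasses κ p} → ℚ := fun i C => (H (uu i) (rep C.1) : ℚ)
  have horth : ∀ i i', i ≠ i' → ∑ C, v i C * v i' C = 0 := by
    intro i i' hii'
    have h1 : ∑ C : {C // C ∈ blockClasses κ p}, v i C * v i' C =
        ∑ C ∈ blockClasses κ p, ((H (uu i) (rep C) * H (uu i') (rep C) : ℤ) : ℚ) := by
      rw [← Finset.sum_coe_sort (blockClasses κ p)]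
      simp [v]
    rw [h1, ← Int.cast_sum, hT i i' hii', Int.cast_zero]
  obtain ⟨C₀, hC₀⟩ : (blockClasses κ p).Nonempty := Finset.card_pos.mp (by rw [hk]; norm_num)
  have hnz : ∀ i, ∃ C, v i C ≠ 0 := by
    intro i
    refine ⟨⟨C₀, hC₀⟩, ?_⟩
    rcases hH.1 (uu i) (rep C₀) with h | h <;> simp [v, h]
  have hle := card_le_of_pairwise_orthogonal v hnz horth
  rw [Fintype.card_coe, hk] at hle
  omega

/-- `w = 1`, `f = 2p + 3`: four fixed rows are impossible -/
private lemma case_w1 (hH : IsHadamardMatrix H) (haut : IsSignedAut H π κ d e) (hp : p.Prime) (hp5 : 5 ≤ p)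
    (hκ : κ ^ p = 1) (uu : Fin 4 → ι) (huu : Function.Injective uu) (hfix : ∀ i, π (uu i) = uu i)
    (rep : Finset ι → ι) (hrep : ∀ C ∈ blockClasses κ p, rep C ∈ C)
    (hk : (blockClasses κ p).card = 1) (hf : (univ.filter fun j => κ j = j).card = 2 * p + 3) : False := by
  have hodd : Odd p := hp.odd_of_ne_two (by omega)
  set Fc := (univ.filter fun j => κ j = j) with hFc
  obtain ⟨C₁, hcls⟩ := Finset.card_eq_one.mp hk
  let ψ : Fin 4 → ℤ := fun i => H (uu i) (rep C₁)
  have hψ : ∀ i, ψ i * ψ i = 1 := fun i => pm_mul_self (hH.1 _ _)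
  let c : Fin 4 → Fin 4 → ℤ := fun i i' => ∑ j ∈ Fc, (ψ i * H (uu i) j) * (ψ i' * H (uu i') j)
  have hc : ∀ i i', c i i' = -(p : ℤ) + (if i = i' then 3 * (p : ℤ) + 3 else 0) := by
    intro i i'
    have hci : c i i' = ψ i * ψ i' * ∑ j ∈ Fc, H (uu i) j * H (uu i') j := by
      simp only [c, Finset.mul_sum]
      apply Finset.sum_congr rfl
      intro j _
      ring
    by_cases hii' : i = i'
    · subst hii'
      rw [if_pos rfl, hci, hψ i, one_mul]
      calc ∑ j ∈ Fc, H (uu i) j * H (uu i) j = ∑ j ∈ Fc, (1 : ℤ) :=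
            Finset.sum_congr rfl (fun j _ => pm_mul_self (hH.1 _ _))
        _ = -(p : ℤ) + (3 * p + 3) := by rw [Finset.sum_const, nsmul_eq_mul, mul_one, hf]; push_cast; ring
    · rw [if_neg hii', hci, add_zero]
      have hs := fixedRows_split hH haut hp hodd hκ (hfix i) (hfix i') (huu.ne hii') rep hrep
      rw [hcls, Finset.sum_singleton] at hs
      have hS : ∑ j ∈ Fc, H (uu i) j * H (uu i') j = -(p : ℤ) * (ψ i * ψ i') := by
        simp only [ψ]; linarith
      rw [hS]
      calc ψ i * ψ i' * (-(p : ℤ) * (ψ i * ψ i')) = -(p : ℤ) * ((ψ i * ψ i) * (ψ i' * ψ i')) := by ring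
        _ = -(p : ℤ) := by rw [hψ i, hψ i', mul_one, mul_one]
  have hQ : (0 : ℤ) ≤ ∑ j ∈ Fc, (∑ i, ψ i * H (uu i) j) * (∑ i, ψ i * H (uu i) j) :=
    Finset.sum_nonneg (fun j _ => mul_self_nonneg _)
  have hQ' : ∑ j ∈ Fc, (∑ i, ψ i * H (uu i) j) * (∑ i, ψ i * H (uu i) j) = ∑ i, ∑ i', c i i' := by
    simp only [c]
    simp_rw [Finset.sum_mul_sum]
    rw [Finset.sum_comm]
    apply Finset.sum_congr rfl
    intro i _
    rw [Finset.sum_comm]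
  have hval : ∑ i : Fin 4, ∑ i' : Fin 4, (-(p : ℤ) + (if i = i' then 3 * (p : ℤ) + 3 else 0)) = 12 - 4 * (p : ℤ) := by
    simp only [Finset.sum_add_distrib, Finset.sum_const, Finset.card_univ, Fintype.card_fin, Finset.sum_ite_eq,
      Finset.mem_univ, if_true]
    ring
  rw [hQ'] at hQ
  simp only [hc] at hQ
  rw [hval] at hQ
  have : (5 : ℤ) ≤ p := by exact_mod_cast hp5
  linarith

/-- extracting `n` distinct fixed rows from a lower bound on their number -/
private lemma fixed_rows_of_le (n : ℕ) (hn : n ≤ (univ.filter fun i => π i = i).card) :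
    ∃ uu : Fin n → ι, Function.Injective uu ∧ ∀ i, π (uu i) = uu i := by
  obtain ⟨t, ht, htc⟩ := Finset.exists_subset_card_eq hn
  let eqv := Finset.equivFinOfCardEq htc
  refine ⟨fun i => (eqv.symm i).1, fun a b h => eqv.symm.injective (Subtype.ext h),
    fun i => (Finset.mem_filter.mp (ht (eqv.symm i).2)).2⟩

/-- class representatives -/
private lemma exists_rep (hp : p.Prime) (hκ : κ ^ p = 1) (x₀ : ι) :
    ∃ rep : Finset ι → ι, ∀ C ∈ blockClasses κ p, rep C ∈ C := by
  classical
  have hne : ∀ C ∈ blockClasses κ p, C.Nonempty := fun C hC =>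
    Finset.card_pos.mp (by rw [card_of_mem_blockClasses κ hp hκ hC]; exact hp.pos)
  refine ⟨fun C => if h : C.Nonempty then h.choose else x₀, fun C hC => ?_⟩
  simp only [dif_pos (hne C hC)]
  exact (hne C hC).choose_spec

/-- the row-count bound in each column-class case: `w = 3 ⇒ f_r ≤ 1`, `w = 2 ⇒ f_r ≤ 2`, `w = 1 ⇒ f_r ≤ 3` -/
private lemma fixedRows_bound (hH : IsHadamardMatrix H) (haut : IsSignedAut H π κ d e) (hp : p.Prime) (hp5 : 5 ≤ p)
    (hι : Fintype.card ι = 3 * p + 3) (hκ : κ ^ p = 1) (w : ℕ) (hw1 : 1 ≤ w) (hw : (blockClasses κ p).card = w) :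
    (univ.filter fun i => π i = i).card ≤ 4 - w := by
  have hcount := card_fixed_add_classes κ hp hκ
  rw [hι, hw] at hcount
  -- w ≤ 3
  have hw3 : w ≤ 3 := by
    by_contra h4
    have : 4 * p ≤ w * p := Nat.mul_le_mul_right p (by omega)
    omega
  obtain ⟨x₀⟩ : Nonempty ι := by
    rw [← Fintype.card_pos_iff, hι]; omega
  obtain ⟨rep, hrep⟩ := exists_rep (κ := κ) hp hκ x₀
  by_contra hlt
  interval_cases w
  · -- w = 1 : f = 2p+3, four fixed rows impossible
    obtain ⟨uu, huu, hfix⟩ := fixed_rows_of_le (π := π) 4 (by omega)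
    exact case_w1 hH haut hp hp5 hκ uu huu hfix rep hrep hw (by omega)
  · obtain ⟨uu, huu, hfix⟩ := fixed_rows_of_le (π := π) 3 (by omega)
    exact case_w2 hH haut hp hp5 hκ uu huu hfix rep hrep hw (by omega)
  · obtain ⟨uu, huu, hfix⟩ := fixed_rows_of_le (π := π) 2 (by omega)
    have h01 : (0 : Fin 2) ≠ 1 := by decide
    exact case_w3 hH haut hp hp5 hκ (hfix 0) (hfix 1) (huu.ne h01) (by omega)

/-- **No Hadamard matrix of order `3p + 3` (`p ≥ 5` prime) has a nontrivial signed automorphism of order `p`.** -/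
theorem no_hadamard_signedAut_order3p3 (hH : IsHadamardMatrix H) (p : ℕ) (hp : p.Prime) (hp5 : 5 ≤ p)
    (hι : Fintype.card ι = 3 * p + 3) (π κ : Equiv.Perm ι) (d e : ι → ℤ) (haut : IsSignedAut H π κ d e)
    (hπ : π ^ p = 1) (hκ : κ ^ p = 1) (hne : π ≠ 1 ∨ κ ≠ 1) : False := by
  have hodd : Odd p := hp.odd_of_ne_two (by omega)
  have hcard : (Fintype.card ι : ℤ) ≠ 0 := by rw [hι]; push_cast; omega
  have hT : IsHadamardMatrix Hᵀ := isHadamard_transpose hH hcard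
  have hautT : IsSignedAut Hᵀ κ π e d := by
    obtain ⟨hd, he, h⟩ := haut
    refine ⟨he, hd, fun j i => ?_⟩
    rw [Matrix.transpose_apply, Matrix.transpose_apply, h i j]; ring
  have hcκ := card_fixed_add_classes κ hp hκ
  have hcπ := card_fixed_add_classes π hp hπ
  rw [hι] at hcκ hcπ
  -- w_κ ≥ 1 (else κ = 1 ⇒ π = 1) and likewise w_π ≥ 1
  have hwκ : 1 ≤ (blockClasses κ p).card := by
    by_contra h0
    have hf : (univ.filter fun j => κ j = j).card = 3 * p + 3 := by
      have : (blockClasses κ p).card = 0 := by omega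
      rw [this, zero_mul, add_zero] at hcκ; exact hcκ
    have hall : (univ.filter fun j => κ j = j) = univ := Finset.eq_univ_of_card _ (by rw [hf, hι])
    have hκ1 : κ = 1 := by
      ext j
      have := (Finset.mem_filter.mp (hall ▸ Finset.mem_univ j)).2
      simpa using this
    have hπ1 : π = 1 := by
      rw [hκ1] at hautT
      exact signedAut_snd_eq_one Hᵀ hT hcard hautT hodd hπ
    rcases hne with h | h
    · exact h hπ1
    · exact h hκ1
  have hwπ : 1 ≤ (blockClasses π p).card := by
    by_contra h0
    have hf : (univ.filter fun i => π i = i).card = 3 * p + 3 := by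
      have : (blockClasses π p).card = 0 := by omega
      rw [this, zero_mul, add_zero] at hcπ; exact hcπ
    have hall : (univ.filter fun i => π i = i) = univ := Finset.eq_univ_of_card _ (by rw [hf, hι])
    have hπ1 : π = 1 := by
      ext i
      have := (Finset.mem_filter.mp (hall ▸ Finset.mem_univ i)).2
      simpa using this
    have hκ1 : κ = 1 := by
      rw [hπ1] at haut
      exact signedAut_snd_eq_one H hH hcard haut hodd hκ
    rcases hne with h | h
    · exact h hπ1
    · exact h hκ1
  -- both fixed counts are ≤ 3 and ≡ 3 (mod p), hence equal to 3, hence both class counts are 3 — contradiction with ≤ 4 − 3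
  have hbr := fixedRows_bound hH haut hp hp5 hι hκ _ hwκ rfl
  have hbc := fixedRows_bound hT hautT hp hp5 hι hπ _ hwπ rfl
  -- from hcπ: f_r + w_r p = 3p+3 with f_r ≤ 3 ⇒ w_r = 3, f_r = 3
  have hwπ3 : (blockClasses π p).card = 3 := by
    have hle : (blockClasses π p).card ≤ 3 := by
      by_contra h4
      have : 4 * p ≤ (blockClasses π p).card * p := Nat.mul_le_mul_right p (by omega)
      omega
    by_contra hne3
    have hle2 : (blockClasses π p).card ≤ 2 := by omega
    have : (blockClasses π p).card * p ≤ 2 * p := Nat.mul_le_mul_right p hle2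
    omega
  rw [hwπ3] at hbc hcπ
  -- hbc: f_c ≤ 1; but f_c + w_c p = 3p+3 with w_c ≤ 3 ⇒ f_c ≥ 3
  have hle3 : (blockClasses κ p).card ≤ 3 := by
    by_contra h4
    have : 4 * p ≤ (blockClasses κ p).card * p := Nat.mul_le_mul_right p (by omega)
    omega
  have : (blockClasses κ p).card * p ≤ 3 * p := Nat.mul_le_mul_right p hle3
  omega

end order3p3

end Summit.Ventures.DiscreteObjects.Hadamard
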